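import Mathlib
import HarnessLib

/-!
# Stubs `stub_windowBlocks` and `stub_windowBoxChange` (AUX3 / AUX4 of W1)

Pure finite-sum combinatorics used by the line `stub_window_nonlinear` of the crux
`PolyMobiusTail` (W1 `stub_nonlinear_window_of_level`):

* `stub_windowBlocks` — a window indicator `[L < t ≤ U]` is the sum over `j < J` of the
  dyadic block indicators `[c j < t ≤ c (j+1)]`, `c j := min (L * 2 ^ j) U`, as soon as
  `0 ≤ L ≤ U ≤ L * 2 ^ J` (telescoping: `c 0 = L`, `c J = U`, `c` monotone);
* `stub_windowBoxChange` — a sum over the box `[1, ⌊D'⌋₊]^k` of a summand supported on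
  `∏ dᵢ ≤ D'` may be taken over any bigger box `[1, ⌊U⌋₊]^k`, `D' ≤ U`.
-/

namespace Summit.Parity.BatemanHorn.Theorems.PolyMobiusTail.NonlinearWindow

/-- A half-open window indicator is a difference of two ray indicators:
`[a < t ≤ b] g = [t ≤ b] g - [t ≤ a] g` whenever `a ≤ b`. -/
private lemma window_ite_eq_sub (g t a b : ℝ) (hab : a ≤ b) :
    (if a < t ∧ t ≤ b then g else 0) = (if t ≤ b then g else 0) - (if t ≤ a then g else 0) := by
  by_cases h1 : t ≤ a
  · rw [if_neg (fun h => (not_lt.2 h1) h.1), if_pos (h1.trans hab), if_pos h1, sub_self]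
  · by_cases h2 : t ≤ b
    · rw [if_pos ⟨not_le.1 h1, h2⟩, if_pos h2, if_neg h1, sub_zero]
    · rw [if_neg (fun h => h2 h.2), if_neg h2, if_neg h1, sub_zero]

/-- Dyadic telescoping of a single window indicator: with cut points
`c j := min (L * 2 ^ j) U` (monotone in `j` since `0 ≤ L`, `c 0 = L`, `c J = U`),
`[L < t ≤ U] g = ∑_{j < J} [c j < t ≤ c (j+1)] g`. -/
private lemma window_ite_eq_sum_blocks (g t L U : ℝ) (J : ℕ) (hL : 0 ≤ L) (hLU : L ≤ U)
    (hJ : U ≤ L * 2 ^ J) :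
    (if L < t ∧ t ≤ U then g else 0) =
      ∑ j ∈ Finset.range J,
        (if min (L * 2 ^ j) U < t ∧ t ≤ min (L * 2 ^ (j + 1)) U then g else 0) := by
  have hmono : ∀ j : ℕ, min (L * 2 ^ j) U ≤ min (L * 2 ^ (j + 1)) U := fun j =>
    min_le_min_right U
      (mul_le_mul_of_nonneg_left (pow_le_pow_right₀ one_le_two (Nat.le_succ j)) hL)
  rw [window_ite_eq_sub g t L U hLU,
    Finset.sum_congr rfl fun j _ => window_ite_eq_sub g t _ _ (hmono j),
    Finset.sum_range_sub (fun j => if t ≤ min (L * 2 ^ j) U then g else 0) J,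
    pow_zero, mul_one, min_eq_left hLU, min_eq_right hJ]

/-- AUX3 (dyadic telescoping of a window indicator): for `0 ≤ L ≤ U ≤ L * 2 ^ J`, the sum of
`g` over the window `L < P d ≤ U` splits into the `J` dyadic blocks
`min (L 2^j) U < P d ≤ min (L 2^(j+1)) U`, `j < J`. -/
theorem stub_windowBlocks : ∀ (k : ℕ) (s : Finset (Fin k → ℕ)) (P g : (Fin k → ℕ) → ℝ) (L U : ℝ) (J : ℕ),
    0 ≤ L → L ≤ U → U ≤ L * 2 ^ J →
    (∑ d ∈ s, if L < P d ∧ P d ≤ U then g d else 0) =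
      ∑ j ∈ Finset.range J, ∑ d ∈ s,
        if min (L * 2 ^ j) U < P d ∧ P d ≤ min (L * 2 ^ (j + 1)) U then g d else 0 := by
  intro k s P g L U J hL hLU hJ
  rw [Finset.sum_comm]
  exact Finset.sum_congr rfl fun d _ => window_ite_eq_sum_blocks (g d) (P d) L U J hL hLU hJ

/-- AUX4 (change of box): a sum over the box `[1, ⌊D'⌋₊]^k` of a summand supported on
`∏ i, d i ≤ D'` equals the same sum over the bigger box `[1, ⌊U⌋₊]^k` (`D' ≤ U`): a tuple of
the big box outside the small one has a coordinate `d i > ⌊D'⌋₊`, hence `∏ d ≥ d i > D'`. -/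
theorem stub_windowBoxChange : ∀ (k : ℕ) (h : (Fin k → ℕ) → ℝ) (D D' U : ℝ), 0 ≤ D' → D' ≤ U →
    (∑ d ∈ Fintype.piFinset (fun _ : Fin k => Finset.Icc 1 ⌊D'⌋₊),
      if D < ∏ i, (d i : ℝ) ∧ ∏ i, (d i : ℝ) ≤ D' then h d else 0) =
    ∑ d ∈ Fintype.piFinset (fun _ : Fin k => Finset.Icc 1 ⌊U⌋₊),
      if D < ∏ i, (d i : ℝ) ∧ ∏ i, (d i : ℝ) ≤ D' then h d else 0 := by
  intro k h D D' U _hD' hD'U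
  apply Finset.sum_subset
  · exact Fintype.piFinset_subset _ _ fun _ =>
      Finset.Icc_subset_Icc le_rfl (Nat.floor_le_floor hD'U)
  · intro d hd hd'
    rw [Fintype.mem_piFinset] at hd hd'
    obtain ⟨i, hi⟩ := not_forall.1 hd'
    have hd1 : ∀ j, 1 ≤ d j := fun j => (Finset.mem_Icc.1 (hd j)).1
    have hiD : ⌊D'⌋₊ < d i := by
      by_contra hle
      exact hi (Finset.mem_Icc.2 ⟨hd1 i, not_lt.1 hle⟩)
    have hlt : D' < (d i : ℝ) := Nat.lt_of_floor_lt hiD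
    have hprod : (d i : ℝ) ≤ ∏ j, (d j : ℝ) := by
      have hnat : d i ≤ ∏ j, d j := Finset.single_le_prod' (fun j _ => hd1 j) (Finset.mem_univ i)
      exact_mod_cast hnat
    exact if_neg fun hc => (hlt.trans_le hprod).not_ge hc.2

end Summit.Parity.BatemanHorn.Theorems.PolyMobiusTail.NonlinearWindow
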